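import Literature.NumberTheory.EllipticCurves.ShimuraCurveHeegnerSystemPrimitivesFromFive
import HarnessLib

/-!
# Route `ErratumRoadFive` (K2, `p ≥ 5`), crux `EulerHalfNotRamNoInertSetAtFive` (item stmt-BirchSwinnertonDyer-19715), line `birth` v13:
# THE REDUCED LABEL BUNDLE AS ONE NAMED PREDICATE — `EulerHalfLABReduced.ReducedLabelsAt`
# (cell `bsd-stepL`, width seat `bsd-line-er5-p1-w2` g4; `--supports stmt-BirchSwinnertonDyer-19715`; ROUTE-FREE: imports one Literature module; DEFINITION ONLY)

WHY. Planner RULING 65 (c) (2026-08-28) itemised the line's one structured input (LAB = HOLE 1, (B6) at the carrier primes) as the route item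
`ShimuraCarrierLabelsB6FromFive` of `Theses/ErratumRoadFive.lean`. The gate caps an item signature at 4 000 characters, so the item was filed with the
INDEX-FREE text (1 799 ch; its label conjunct is `Theorems.ShimuraWalk.LabelsAt W N K ι y ys ε`, which still contains the `K`-level conjugation label
(B3₀) — derivable from (B2) + (B3), `ShimuraKolyvaginConjKLevel.isOfFinAddOrder_map_sub_smul_of_labels`), not with the REDUCED text of
`EulerHalfLABReduced.carrierLabelsB6AtFive_of_reducedLAB` (p634781; 5 546 ch, the five printed labels written out). The planner's adjustment (2)
(HOME STATUS 2026-08-28T13:32:52Z): «the REDUCED form becomes the phase-2 restatement once the reduced five-label bundle has a DEF NAME». This file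
IS that name and nothing else: with it the REDUCED text reads «… ∧ `EulerHalfLABReduced.ReducedLabelsAt W N K ι y ys ε` ∧ (B6)@carriers», ≈ 1 770 ch.
The same name serves any later currency for the (B6) conjunct (E′-label, receptacle form): those texts exceed the cap too when the labels are spelled out.

WHAT. ONE definition with body, `ReducedLabelsAt W N K ι y ys ε : Prop` := (ε) `ε = ±1` ∧ (B2) Gross (4.1) bottom trace ∧ (B3) Gross 5.3 conjugation at
every level ∧ (B4) Gross 3.7 (1) norm relation ∧ (B5) Gross 3.7 (2) congruence (image-free form) — BYTE-IDENTICAL (modulo indentation) to the binder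
`hred` of `EulerHalfLABReduced.labelsAt_of_reducedLabels` (p634781 §1), i.e. to `Theorems.ShimuraWalk.LabelsAt` (`ClassRecordThreeCornerAtThreeShimuraWalkDefs`)
with its fourth conjunct (B3₀) deleted, i.e. to conjuncts 4–8 of the conclusion of the Literature fact
`Literature.NumberTheory.EllipticCurves.shimuraCurve_heegnerSystem_primitivesFromFive` (route item 20442). The bookkeeping THEOREMS live in the
proof file `Theorems/ErratumRoadFiveEulerHalfNotRamLABReducedOfDef.lean` (same namespace): `labelsAt_of_reducedLabelsAt` ∕ `reducedLabelsAt_of_labelsAt`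
(⟺ `ShimuraWalk.LabelsAt` for `K` imaginary quadratic), `reducedLAB_of_reducedLABDef` ∕ `reducedLABDef_of_reducedLAB` (the REDUCED text written with
this def ⟺ p634781's `hRed` text), `indexFreeLAB_of_reducedLABDef` (⟹ the FILED item (ii) text VERBATIM) and `exists_reducedLabelsAt_of_primitivesFromFive`
(route item 20442 ⟹ degree clause ∧ display ∧ `ReducedLabelsAt` in its own frame).

HONEST FRAMING: a PREDICATE (definition with body); nothing is asserted, no theorem, no named fact, no instance, no notation, no `sorry`; item 19715 is NOT closed
by this file; no census number moves; BSD is proved for no curve; no summit statement is touched.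
[cite: GrossLMS1991, §3 Prop. 3.7 (1)(2), §4 (4.1), §5 (5.2), Prop. 5.3] [cite: BertoliniDarmon1996, §2.4, §2.5, Prop. 2.6] [cite: Nekovar2007, (4.8), (4.9)]
-/

set_option autoImplicit false
set_option linter.dupNamespace false -- `Summit.BirchSwinnertonDyer.BirchSwinnertonDyer` (summit = problem), tree-wide

noncomputable section

open scoped Classical

namespace Summit.BirchSwinnertonDyer.BirchSwinnertonDyer.Theorems.EulerHalfLABReduced

/-- **The reduced label bundle of a CM family `(ι, y, ys, ε)` on `E = W/ℚ` of level `N` over the ring class fields of `K`** — the five PRINTED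
labels of route item 20442 (`shimuraCurve_heegnerSystem_primitivesFromFive`, conjuncts 4–8 of its conclusion) as ONE predicate:
(ε) `ε = 1 ∨ ε = −1` (sign of the main involution, Gross (5.2) ∕ Bertolini–Darmon Prop. 2.6);
(B2) `y ↦ E(K[1])` equals `∑_{g ∈ Gal(K[1]/K)} g · ys 1` (Gross (4.1); Bertolini–Darmon §2.5);
(B3) for `m ≠ 0` and every lift `τ_m` of complex conjugation, `τ_m (ys m) − ε · σ′ (ys m)` is torsion for some `σ′ ∈ Gal(K[m]/K)` (Gross Prop. 5.3);
(B4) `∑_{i=0}^{ℓ} σ^i (ys m) = a_ℓ · (ys (m/ℓ))↑` for square-free `m` with prime factors `q ∤ N` inert in `K`, `ℓ ∣ m`, `σ` generating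
`Gal(K[m]/K[m/ℓ])` (Gross Prop. 3.7 (1); Nekovář (4.8));
(B5) `red(γ · ys m) = Frob_ℓ · red(γ · (ys (m/ℓ))↑)` in `E(𝔽̄_ℓ)` for the same `m`, `ℓ ∤ Δ_min`, every `K`-embedding of `K[m]` into `K̄` and every
`γ ∈ Gal(K[m]/K)` (Gross Prop. 3.7 (2); Nekovář (4.9)).
It is `Theorems.ShimuraWalk.LabelsAt W N K ι y ys ε` WITHOUT its `K`-level conjugation conjunct (B3₀) (which follows from (B2) + (B3):
`ShimuraKolyvaginConjKLevel.isOfFinAddOrder_map_sub_smul_of_labels`), and is byte-identical to the binder `hred` of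
`EulerHalfLABReduced.labelsAt_of_reducedLabels`. A PREDICATE; nothing is asserted.
[cite: GrossLMS1991, §3 Prop. 3.7 (1)(2), §4 (4.1), §5 (5.2), Prop. 5.3] [cite: BertoliniDarmon1996, §2.4, §2.5, Prop. 2.6]
[cite: Nekovar2007, (4.8), (4.9)] -/
def ReducedLabelsAt (W : WeierstrassCurve ℚ) [W.IsElliptic] [W.IsGloballyMinimal] (N : ℕ) (K : Type) [Field K] [NumberField K]
    (ι : K →+* ℂ) (y : (W.baseChange K).toAffine.Point)
    (ys : (m : ℕ) → (W.baseChange (Literature.NumberTheory.EllipticCurves.ringClassField K ι m)).toAffine.Point) (ε : ℤ) : Prop :=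
      (ε = 1 ∨ ε = -1) ∧
      (∀ T : Finset (Literature.NumberTheory.EllipticCurves.ringClassField K ι 1 ≃ₐ[ℚ] Literature.NumberTheory.EllipticCurves.ringClassField K ι 1),
    (∀ g, g ∈ T ↔ g ∈ Literature.NumberTheory.EllipticCurves.ringClassGal ι 1) →
    WeierstrassCurve.Affine.Point.map (W' := W)
        (algebraMap K (Literature.NumberTheory.EllipticCurves.ringClassField K ι 1)).toRatAlgHom y =
      ∑ g ∈ T, Literature.NumberTheory.EllipticCurves.pointGalHom W (Literature.NumberTheory.EllipticCurves.ringClassField K ι 1) g (ys 1)) ∧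
      (∀ (m : ℕ), m ≠ 0 → ∀ τm : Literature.NumberTheory.EllipticCurves.ringClassField K ι m ≃ₐ[ℚ] Literature.NumberTheory.EllipticCurves.ringClassField K ι m,
    (∀ x : Literature.NumberTheory.EllipticCurves.ringClassField K ι m, ((τm x : Literature.NumberTheory.EllipticCurves.ringClassField K ι m) : ℂ) = starRingEnd ℂ x) →
    ∃ σ' ∈ Literature.NumberTheory.EllipticCurves.ringClassGal ι m, IsOfFinAddOrder
      (Literature.NumberTheory.EllipticCurves.pointGalHom W (Literature.NumberTheory.EllipticCurves.ringClassField K ι m) τm (ys m) -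
        ε • Literature.NumberTheory.EllipticCurves.pointGalHom W (Literature.NumberTheory.EllipticCurves.ringClassField K ι m) σ' (ys m))) ∧
      (∀ m : ℕ, Squarefree m →
    (∀ q ∈ m.primeFactors, ¬ q ∣ N ∧ (Ideal.span {(q : NumberField.RingOfIntegers K)}).IsPrime) →
    ∀ (ℓ : ℕ) (_ : ℓ ∈ m.primeFactors) (hle : Literature.NumberTheory.EllipticCurves.ringClassField K ι (m / ℓ) ≤ Literature.NumberTheory.EllipticCurves.ringClassField K ι m)
      (σ : Literature.NumberTheory.EllipticCurves.ringClassField K ι m ≃ₐ[ℚ] Literature.NumberTheory.EllipticCurves.ringClassField K ι m),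
      Subgroup.zpowers σ = Literature.NumberTheory.EllipticCurves.ringClassGalOver ι m (m / ℓ) →
      letI : Algebra K ℂ := ι.toAlgebra
      ∑ i ∈ Finset.range (ℓ + 1), Literature.NumberTheory.EllipticCurves.pointGalHom W (Literature.NumberTheory.EllipticCurves.ringClassField K ι m) (σ ^ i) (ys m) =
        W.frobeniusTrace ℓ • WeierstrassCurve.Affine.Point.map (W' := W)
          ((Literature.NumberTheory.EllipticCurves.RingClassField.inclusion ι hle).restrictScalars ℚ) (ys (m / ℓ))) ∧
      (∀ m : ℕ, Squarefree m →
    (∀ q ∈ m.primeFactors, ¬ q ∣ N ∧ (Ideal.span {(q : NumberField.RingOfIntegers K)}).IsPrime) →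
    ∀ (ℓ : ℕ) (_ : ℓ ∈ m.primeFactors) [Fact ℓ.Prime] (hΔ : ¬ (ℓ : ℤ) ∣ W.minimalDiscriminantInt)
      (φ₀ : Field.absoluteGaloisGroup (ZMod ℓ)), (∀ x : AlgebraicClosure (ZMod ℓ), φ₀ • x = x ^ ℓ) →
    ∀ (hle : Literature.NumberTheory.EllipticCurves.ringClassField K ι (m / ℓ) ≤ Literature.NumberTheory.EllipticCurves.ringClassField K ι m)
      (emb : Literature.NumberTheory.EllipticCurves.ringClassField K ι m →+* AlgebraicClosure K),
      (∀ x : K, emb (algebraMap K (Literature.NumberTheory.EllipticCurves.ringClassField K ι m) x) = algebraMap K (AlgebraicClosure K) x) →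
    ∀ (j : (W.baseChange (Literature.NumberTheory.EllipticCurves.ringClassField K ι m)).toAffine.Point →+ (W.baseChange K).geomPoints),
      j = WeierstrassCurve.Affine.Point.map (W' := W) emb.toRatAlgHom →
    ∀ γ : Literature.NumberTheory.EllipticCurves.ringClassField K ι m ≃ₐ[ℚ] Literature.NumberTheory.EllipticCurves.ringClassField K ι m, γ ∈ Literature.NumberTheory.EllipticCurves.ringClassGal ι m →
      letI : Algebra K ℂ := ι.toAlgebra
      Literature.NumberTheory.EllipticCurves.geomReduction hΔ ((Literature.NumberTheory.EllipticCurves.RatClosure.pointsEquiv (K := K) W).symm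
          (j (Literature.NumberTheory.EllipticCurves.pointGalHom W (Literature.NumberTheory.EllipticCurves.ringClassField K ι m) γ (ys m)))) =
        φ₀ • Literature.NumberTheory.EllipticCurves.geomReduction hΔ ((Literature.NumberTheory.EllipticCurves.RatClosure.pointsEquiv (K := K) W).symm
          (j (Literature.NumberTheory.EllipticCurves.pointGalHom W (Literature.NumberTheory.EllipticCurves.ringClassField K ι m) γ
            (WeierstrassCurve.Affine.Point.map (W' := W)
              ((Literature.NumberTheory.EllipticCurves.RingClassField.inclusion ι hle).restrictScalars ℚ) (ys (m / ℓ)))))))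


end Summit.BirchSwinnertonDyer.BirchSwinnertonDyer.Theorems.EulerHalfLABReduced

end
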